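import Summits.Ventures.Crystal3D.Theorems.StickyWulffConstantNoReconstructionGainFourFamilyLocal
import Summits.Ventures.Crystal3D.Theorems.StickyWulffConstantNoReconstructionGainSymmetry
import Summits.Ventures.Crystal3D.Theorems.StickyWulffConstantNoReconstructionGainRegistry
import Mathlib.Analysis.InnerProductSpace.Projection.Reflection
import Mathlib.GroupTheory.Perm.Sign
import Mathlib.Data.Fin.Tuple.Sort
import HarnessLib

/-!
# The cube group on the four `{111}` families, I: half-turns about bonds

HONEST FRAMING. Part of the venture `Summits/Ventures/Crystal3D` (cell `crystal3d-full`), helper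
`--supports` the crux `NoReconstructionGain` (stmt-Ventures-19144, route
`route-Ventures-StickyWulffConstant`), line `adhesion`; first half of the covering lemma for the cone
hypothesis of `fourFamilyBarlowFilm_slab_orbit` (class (ii), films on `(1/3)Λ₀`).

The scaled family normals `N_f = (1/3) pos(L_f)` (`L_0 = (3,−1,−1)` i.e. `layerNormal`,
`L_1 = (−1,−1,3)`, `L_2 = (−1,3,−1)`, `L_3 = (−1,−1,−1)`) are permuted up to a global sign by the
half-turns about the six bonds `d_fg = (3/4)(N_f − N_g)` (unit lattice vectors `pos 1 0 (−1)`,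
`pos 1 (−1) 0`, `pos 1 0 0`, `pos 0 (−1) 1`, `pos 0 0 1`, `pos 0 1 0`): `R N_f = −N_g`, `R N_g = −N_f`,
`R N_h = −N_h` otherwise.  Half-turns about bonds are lattice isometries: the Gram form of the fcc
labels is integral (`2⟪pos L, pos l⟫ ∈ ℤ`).

* `barlowPos_inner` — the Gram form; `exists_halfTurn_pos`, `halfTurn_pos_lattice` — half-turns about
  unit lattice vectors exist (`Submodule.reflection` of the line) and map `Λ₀` onto itself;
* `third_lincomb`, `head_combo` — label bookkeeping (`barlowPos_fcc_neg` from `…Registry`);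
* `halfTurn_step_01 … halfTurn_step_23` — the six transpositions with their action on `N_0..N_3`.

WHAT THIS IS NOT: the permutation / sorting statements (part II); F-C1 not moved.
-/

noncomputable section

namespace Summit.Ventures.Crystal3D.Theorems

open Summit.Ventures.Crystal3D Finset
open Literature.MathematicalPhysics.StatisticalMechanics (barlowPos fccStacking barlowOffset layerNormal constHagg
  haggLabel_const barlowPos_apply_zero barlowPos_apply_one barlowPos_apply_two mem_barlowStacking_iff)
open scoped InnerProductSpace

/-- The Gram form of the fcc labels. -/
theorem barlowPos_inner (k i j k' i' j' : ℤ) :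
    ⟪barlowPos 1 (Real.sqrt (2 / 3)) constHagg k i j, barlowPos 1 (Real.sqrt (2 / 3)) constHagg k' i' j'⟫_ℝ =
      ((i : ℝ) + j / 2 + k / 2) * ((i' : ℝ) + j' / 2 + k' / 2) + 3 / 4 * (((j : ℝ) + k / 3) * ((j' : ℝ) + k' / 3))
        + 2 / 3 * ((k : ℝ) * k') := by
  have h3 : Real.sqrt 3 ^ 2 = 3 := Real.sq_sqrt (by norm_num)
  have hh : Real.sqrt (2 / 3) ^ 2 = 2 / 3 := Real.sq_sqrt (by norm_num)
  rw [EuclideanSpace.inner_eq_star_dotProduct]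
  simp only [star_trivial, dotProduct, Fin.sum_univ_three]
  simp only [barlowPos_apply_zero, barlowPos_apply_one, barlowPos_apply_two, haggLabel_const, one_mul]
  linear_combination ((j : ℝ) + k / 3) * ((j' : ℝ) + k' / 3) / 4 * h3 + (k : ℝ) * (k' : ℝ) * hh

/-- The half-turn about a unit lattice vector exists as a linear isometry: `R x = 2⟪x, d⟫ d − x`. -/
theorem exists_halfTurn_pos (k i j : ℤ) (hd : ‖barlowPos 1 (Real.sqrt (2 / 3)) constHagg k i j‖ ^ 2 = 1) :
    ∃ R : EuclideanSpace ℝ (Fin 3) ≃ₗᵢ[ℝ] EuclideanSpace ℝ (Fin 3),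
      ∀ x, R x = (2 * ⟪x, barlowPos 1 (Real.sqrt (2 / 3)) constHagg k i j⟫_ℝ) • barlowPos 1 (Real.sqrt (2 / 3)) constHagg k i j - x := by
  set t : EuclideanSpace ℝ (Fin 3) := barlowPos 1 (Real.sqrt (2 / 3)) constHagg k i j with ht
  have e : (‖t‖ : ℝ) = 1 := by
    have h0 : 0 ≤ ‖t‖ := norm_nonneg _
    nlinarith [hd]
  refine ⟨(ℝ ∙ t).reflection, fun x => ?_⟩
  rw [Submodule.reflection_singleton_apply, two_smul, real_inner_comm t x]
  simp [e]
  module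

/-- A half-turn about a unit lattice vector maps `Λ₀` onto itself (integral Gram form; involution). -/
theorem halfTurn_pos_lattice (R : EuclideanSpace ℝ (Fin 3) ≃ₗᵢ[ℝ] EuclideanSpace ℝ (Fin 3)) (k i j : ℤ)
    (hd : ‖barlowPos 1 (Real.sqrt (2 / 3)) constHagg k i j‖ ^ 2 = 1)
    (hR : ∀ x, R x = (2 * ⟪x, barlowPos 1 (Real.sqrt (2 / 3)) constHagg k i j⟫_ℝ) • barlowPos 1 (Real.sqrt (2 / 3)) constHagg k i j - x) :
    (∀ p ∈ fccStacking 1 (Real.sqrt (2 / 3)), R p ∈ fccStacking 1 (Real.sqrt (2 / 3))) ∧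
    (∀ p ∈ fccStacking 1 (Real.sqrt (2 / 3)), R.symm p ∈ fccStacking 1 (Real.sqrt (2 / 3))) := by
  have hmem : ∀ p ∈ fccStacking 1 (Real.sqrt (2 / 3)), R p ∈ fccStacking 1 (Real.sqrt (2 / 3)) := by
    intro p hp
    obtain ⟨K, I, J, rfl⟩ := mem_barlowStacking_iff.1 hp
    set m : ℤ := 2 * I * i + 2 * J * j + 2 * K * k + I * j + J * i + I * k + K * i + J * k + K * j with hm
    have hinner : 2 * ⟪barlowPos 1 (Real.sqrt (2 / 3)) constHagg K I J, barlowPos 1 (Real.sqrt (2 / 3)) constHagg k i j⟫_ℝ = (m : ℝ) := by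
      rw [barlowPos_inner, hm]; push_cast; ring
    refine ⟨m * k + (-1) * K, m * i + (-1) * I, m * j + (-1) * J, ?_⟩
    rw [hR, hinner, ← barlowPos_zlin m (-1) k i j K I J]
    simp only [Int.cast_neg, Int.cast_one, neg_smul, one_smul]
    abel
  have hinv : ∀ x, R (R x) = x := by
    intro x
    have ht : ⟪barlowPos 1 (Real.sqrt (2 / 3)) constHagg k i j, barlowPos 1 (Real.sqrt (2 / 3)) constHagg k i j⟫_ℝ = 1 := by
      rw [real_inner_self_eq_norm_sq, hd]
    rw [hR (R x), hR x, inner_sub_left, real_inner_smul_left, ht]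
    module
  refine ⟨hmem, fun p hp => ?_⟩
  have : R.symm p = R p := by
    calc R.symm p = R.symm (R (R p)) := by rw [hinv]
      _ = R p := R.symm_apply_apply _
  rw [this]
  exact hmem p hp

/-- Label bookkeeping for the half-turn identities:
`(2·(1/3)·G) • pos l − (1/3) • pos L = −(1/3) • pos L'` when `2G = c` and `c l − L = −L'`. -/
theorem third_lincomb (c k i j K I J K' I' J' : ℤ) (G : ℝ) (hG : 2 * G = c)
    (hk : c * k - K = -K') (hi : c * i - I = -I') (hj : c * j - J = -J') :
    (2 * ((1 / 3 : ℝ) * G)) • barlowPos 1 (Real.sqrt (2 / 3)) constHagg k i j - (1 / 3 : ℝ) • barlowPos 1 (Real.sqrt (2 / 3)) constHagg K I J =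
      -((1 / 3 : ℝ) • barlowPos 1 (Real.sqrt (2 / 3)) constHagg K' I' J') := by
  have e1 := barlowPos_zlin c (-1) k i j K I J
  have e2 := barlowPos_zlin (-1) 0 K' I' J' 0 0 0
  simp only [Int.cast_neg, Int.cast_one, neg_smul, one_smul, Int.cast_zero, zero_smul, add_zero,
    neg_mul, one_mul, mul_zero] at e1 e2
  rw [show c * k + -K = -K' by rw [← hk]; ring, show c * i + -I = -I' by rw [← hi]; ring,
    show c * j + -J = -J' by rw [← hj]; ring, ← e2] at e1
  rw [show (2 * ((1 / 3 : ℝ) * G)) = (1 / 3 : ℝ) * (c : ℝ) by rw [← hG]; ring, mul_smul, ← smul_sub,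
    sub_eq_add_neg, e1, smul_neg]

/-- `−pos l = (3/4) • (N' − N)` when `4 l = L − L'` (heads as differences of family normals). -/
theorem head_combo (k i j K I J K' I' J' : ℤ)
    (hk : 4 * k = K - K') (hi : 4 * i = I - I') (hj : 4 * j = J - J') :
    -barlowPos 1 (Real.sqrt (2 / 3)) constHagg k i j =
      (3 / 4 : ℝ) • ((1 / 3 : ℝ) • barlowPos 1 (Real.sqrt (2 / 3)) constHagg K' I' J' - (1 / 3 : ℝ) • barlowPos 1 (Real.sqrt (2 / 3)) constHagg K I J) := by
  have e1 := barlowPos_zlin 1 (-1) K' I' J' K I J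
  have e2 := barlowPos_zlin (-4) 0 k i j 0 0 0
  simp only [Int.cast_one, one_smul, Int.cast_neg, neg_smul, one_mul, neg_mul, Int.cast_ofNat,
    Int.cast_zero, zero_smul, add_zero, mul_zero] at e1 e2
  rw [show K' + -K = -(4 * k) by rw [hk]; ring, show I' + -I = -(4 * i) by rw [hi]; ring,
    show J' + -J = -(4 * j) by rw [hj]; ring, ← e2] at e1
  rw [← smul_sub, sub_eq_add_neg, e1]
  module

/-- Half-turn about the bond `pos (1, 0, -1)`: swaps families `0` and `1` up to sign. -/
theorem halfTurn_step_01 :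
    ∃ R : EuclideanSpace ℝ (Fin 3) ≃ₗᵢ[ℝ] EuclideanSpace ℝ (Fin 3),
      (∀ p ∈ fccStacking 1 (Real.sqrt (2 / 3)), R p ∈ fccStacking 1 (Real.sqrt (2 / 3))) ∧
      (∀ p ∈ fccStacking 1 (Real.sqrt (2 / 3)), R.symm p ∈ fccStacking 1 (Real.sqrt (2 / 3))) ∧
      R ((1 / 3 : ℝ) • barlowPos 1 (Real.sqrt (2 / 3)) constHagg 3 (-1) (-1)) = -((1 / 3 : ℝ) • barlowPos 1 (Real.sqrt (2 / 3)) constHagg (-1) (-1) 3) ∧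
      R ((1 / 3 : ℝ) • barlowPos 1 (Real.sqrt (2 / 3)) constHagg (-1) (-1) 3) = -((1 / 3 : ℝ) • barlowPos 1 (Real.sqrt (2 / 3)) constHagg 3 (-1) (-1)) ∧
      R ((1 / 3 : ℝ) • barlowPos 1 (Real.sqrt (2 / 3)) constHagg (-1) 3 (-1)) = -((1 / 3 : ℝ) • barlowPos 1 (Real.sqrt (2 / 3)) constHagg (-1) 3 (-1)) ∧
      R ((1 / 3 : ℝ) • barlowPos 1 (Real.sqrt (2 / 3)) constHagg (-1) (-1) (-1)) = -((1 / 3 : ℝ) • barlowPos 1 (Real.sqrt (2 / 3)) constHagg (-1) (-1) (-1)) := by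
  have hd : ‖barlowPos 1 (Real.sqrt (2 / 3)) constHagg 1 0 (-1)‖ ^ 2 = 1 := by rw [barlowPos_normSq]; push_cast; norm_num
  obtain ⟨R, hR⟩ := exists_halfTurn_pos 1 0 (-1) hd
  have hl := halfTurn_pos_lattice R 1 0 (-1) hd hR
  refine ⟨R, hl.1, hl.2, ?_, ?_, ?_, ?_⟩
  · rw [hR, real_inner_smul_left, barlowPos_inner]
    exact third_lincomb 4 1 0 (-1) 3 (-1) (-1) (-1) (-1) 3 _
      (by push_cast; norm_num) (by norm_num) (by norm_num) (by norm_num)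
  · rw [hR, real_inner_smul_left, barlowPos_inner]
    exact third_lincomb (-4) 1 0 (-1) (-1) (-1) 3 3 (-1) (-1) _
      (by push_cast; norm_num) (by norm_num) (by norm_num) (by norm_num)
  · rw [hR, real_inner_smul_left, barlowPos_inner]
    exact third_lincomb 0 1 0 (-1) (-1) 3 (-1) (-1) 3 (-1) _
      (by push_cast; norm_num) (by norm_num) (by norm_num) (by norm_num)
  · rw [hR, real_inner_smul_left, barlowPos_inner]
    exact third_lincomb 0 1 0 (-1) (-1) (-1) (-1) (-1) (-1) (-1) _
      (by push_cast; norm_num) (by norm_num) (by norm_num) (by norm_num)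

/-- Half-turn about the bond `pos (1, -1, 0)`: swaps families `0` and `2` up to sign. -/
theorem halfTurn_step_02 :
    ∃ R : EuclideanSpace ℝ (Fin 3) ≃ₗᵢ[ℝ] EuclideanSpace ℝ (Fin 3),
      (∀ p ∈ fccStacking 1 (Real.sqrt (2 / 3)), R p ∈ fccStacking 1 (Real.sqrt (2 / 3))) ∧
      (∀ p ∈ fccStacking 1 (Real.sqrt (2 / 3)), R.symm p ∈ fccStacking 1 (Real.sqrt (2 / 3))) ∧
      R ((1 / 3 : ℝ) • barlowPos 1 (Real.sqrt (2 / 3)) constHagg 3 (-1) (-1)) = -((1 / 3 : ℝ) • barlowPos 1 (Real.sqrt (2 / 3)) constHagg (-1) 3 (-1)) ∧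
      R ((1 / 3 : ℝ) • barlowPos 1 (Real.sqrt (2 / 3)) constHagg (-1) (-1) 3) = -((1 / 3 : ℝ) • barlowPos 1 (Real.sqrt (2 / 3)) constHagg (-1) (-1) 3) ∧
      R ((1 / 3 : ℝ) • barlowPos 1 (Real.sqrt (2 / 3)) constHagg (-1) 3 (-1)) = -((1 / 3 : ℝ) • barlowPos 1 (Real.sqrt (2 / 3)) constHagg 3 (-1) (-1)) ∧
      R ((1 / 3 : ℝ) • barlowPos 1 (Real.sqrt (2 / 3)) constHagg (-1) (-1) (-1)) = -((1 / 3 : ℝ) • barlowPos 1 (Real.sqrt (2 / 3)) constHagg (-1) (-1) (-1)) := by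
  have hd : ‖barlowPos 1 (Real.sqrt (2 / 3)) constHagg 1 (-1) 0‖ ^ 2 = 1 := by rw [barlowPos_normSq]; push_cast; norm_num
  obtain ⟨R, hR⟩ := exists_halfTurn_pos 1 (-1) 0 hd
  have hl := halfTurn_pos_lattice R 1 (-1) 0 hd hR
  refine ⟨R, hl.1, hl.2, ?_, ?_, ?_, ?_⟩
  · rw [hR, real_inner_smul_left, barlowPos_inner]
    exact third_lincomb 4 1 (-1) 0 3 (-1) (-1) (-1) 3 (-1) _
      (by push_cast; norm_num) (by norm_num) (by norm_num) (by norm_num)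
  · rw [hR, real_inner_smul_left, barlowPos_inner]
    exact third_lincomb 0 1 (-1) 0 (-1) (-1) 3 (-1) (-1) 3 _
      (by push_cast; norm_num) (by norm_num) (by norm_num) (by norm_num)
  · rw [hR, real_inner_smul_left, barlowPos_inner]
    exact third_lincomb (-4) 1 (-1) 0 (-1) 3 (-1) 3 (-1) (-1) _
      (by push_cast; norm_num) (by norm_num) (by norm_num) (by norm_num)
  · rw [hR, real_inner_smul_left, barlowPos_inner]
    exact third_lincomb 0 1 (-1) 0 (-1) (-1) (-1) (-1) (-1) (-1) _
      (by push_cast; norm_num) (by norm_num) (by norm_num) (by norm_num)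

/-- Half-turn about the bond `pos (1, 0, 0)`: swaps families `0` and `3` up to sign. -/
theorem halfTurn_step_03 :
    ∃ R : EuclideanSpace ℝ (Fin 3) ≃ₗᵢ[ℝ] EuclideanSpace ℝ (Fin 3),
      (∀ p ∈ fccStacking 1 (Real.sqrt (2 / 3)), R p ∈ fccStacking 1 (Real.sqrt (2 / 3))) ∧
      (∀ p ∈ fccStacking 1 (Real.sqrt (2 / 3)), R.symm p ∈ fccStacking 1 (Real.sqrt (2 / 3))) ∧
      R ((1 / 3 : ℝ) • barlowPos 1 (Real.sqrt (2 / 3)) constHagg 3 (-1) (-1)) = -((1 / 3 : ℝ) • barlowPos 1 (Real.sqrt (2 / 3)) constHagg (-1) (-1) (-1)) ∧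
      R ((1 / 3 : ℝ) • barlowPos 1 (Real.sqrt (2 / 3)) constHagg (-1) (-1) 3) = -((1 / 3 : ℝ) • barlowPos 1 (Real.sqrt (2 / 3)) constHagg (-1) (-1) 3) ∧
      R ((1 / 3 : ℝ) • barlowPos 1 (Real.sqrt (2 / 3)) constHagg (-1) 3 (-1)) = -((1 / 3 : ℝ) • barlowPos 1 (Real.sqrt (2 / 3)) constHagg (-1) 3 (-1)) ∧
      R ((1 / 3 : ℝ) • barlowPos 1 (Real.sqrt (2 / 3)) constHagg (-1) (-1) (-1)) = -((1 / 3 : ℝ) • barlowPos 1 (Real.sqrt (2 / 3)) constHagg 3 (-1) (-1)) := by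
  have hd : ‖barlowPos 1 (Real.sqrt (2 / 3)) constHagg 1 0 0‖ ^ 2 = 1 := by rw [barlowPos_normSq]; push_cast; norm_num
  obtain ⟨R, hR⟩ := exists_halfTurn_pos 1 0 0 hd
  have hl := halfTurn_pos_lattice R 1 0 0 hd hR
  refine ⟨R, hl.1, hl.2, ?_, ?_, ?_, ?_⟩
  · rw [hR, real_inner_smul_left, barlowPos_inner]
    exact third_lincomb 4 1 0 0 3 (-1) (-1) (-1) (-1) (-1) _
      (by push_cast; norm_num) (by norm_num) (by norm_num) (by norm_num)
  · rw [hR, real_inner_smul_left, barlowPos_inner]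
    exact third_lincomb 0 1 0 0 (-1) (-1) 3 (-1) (-1) 3 _
      (by push_cast; norm_num) (by norm_num) (by norm_num) (by norm_num)
  · rw [hR, real_inner_smul_left, barlowPos_inner]
    exact third_lincomb 0 1 0 0 (-1) 3 (-1) (-1) 3 (-1) _
      (by push_cast; norm_num) (by norm_num) (by norm_num) (by norm_num)
  · rw [hR, real_inner_smul_left, barlowPos_inner]
    exact third_lincomb (-4) 1 0 0 (-1) (-1) (-1) 3 (-1) (-1) _
      (by push_cast; norm_num) (by norm_num) (by norm_num) (by norm_num)

/-- Half-turn about the bond `pos (0, -1, 1)`: swaps families `1` and `2` up to sign. -/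
theorem halfTurn_step_12 :
    ∃ R : EuclideanSpace ℝ (Fin 3) ≃ₗᵢ[ℝ] EuclideanSpace ℝ (Fin 3),
      (∀ p ∈ fccStacking 1 (Real.sqrt (2 / 3)), R p ∈ fccStacking 1 (Real.sqrt (2 / 3))) ∧
      (∀ p ∈ fccStacking 1 (Real.sqrt (2 / 3)), R.symm p ∈ fccStacking 1 (Real.sqrt (2 / 3))) ∧
      R ((1 / 3 : ℝ) • barlowPos 1 (Real.sqrt (2 / 3)) constHagg 3 (-1) (-1)) = -((1 / 3 : ℝ) • barlowPos 1 (Real.sqrt (2 / 3)) constHagg 3 (-1) (-1)) ∧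
      R ((1 / 3 : ℝ) • barlowPos 1 (Real.sqrt (2 / 3)) constHagg (-1) (-1) 3) = -((1 / 3 : ℝ) • barlowPos 1 (Real.sqrt (2 / 3)) constHagg (-1) 3 (-1)) ∧
      R ((1 / 3 : ℝ) • barlowPos 1 (Real.sqrt (2 / 3)) constHagg (-1) 3 (-1)) = -((1 / 3 : ℝ) • barlowPos 1 (Real.sqrt (2 / 3)) constHagg (-1) (-1) 3) ∧
      R ((1 / 3 : ℝ) • barlowPos 1 (Real.sqrt (2 / 3)) constHagg (-1) (-1) (-1)) = -((1 / 3 : ℝ) • barlowPos 1 (Real.sqrt (2 / 3)) constHagg (-1) (-1) (-1)) := by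
  have hd : ‖barlowPos 1 (Real.sqrt (2 / 3)) constHagg 0 (-1) 1‖ ^ 2 = 1 := by rw [barlowPos_normSq]; push_cast; norm_num
  obtain ⟨R, hR⟩ := exists_halfTurn_pos 0 (-1) 1 hd
  have hl := halfTurn_pos_lattice R 0 (-1) 1 hd hR
  refine ⟨R, hl.1, hl.2, ?_, ?_, ?_, ?_⟩
  · rw [hR, real_inner_smul_left, barlowPos_inner]
    exact third_lincomb 0 0 (-1) 1 3 (-1) (-1) 3 (-1) (-1) _
      (by push_cast; norm_num) (by norm_num) (by norm_num) (by norm_num)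
  · rw [hR, real_inner_smul_left, barlowPos_inner]
    exact third_lincomb 4 0 (-1) 1 (-1) (-1) 3 (-1) 3 (-1) _
      (by push_cast; norm_num) (by norm_num) (by norm_num) (by norm_num)
  · rw [hR, real_inner_smul_left, barlowPos_inner]
    exact third_lincomb (-4) 0 (-1) 1 (-1) 3 (-1) (-1) (-1) 3 _
      (by push_cast; norm_num) (by norm_num) (by norm_num) (by norm_num)
  · rw [hR, real_inner_smul_left, barlowPos_inner]
    exact third_lincomb 0 0 (-1) 1 (-1) (-1) (-1) (-1) (-1) (-1) _
      (by push_cast; norm_num) (by norm_num) (by norm_num) (by norm_num)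

/-- Half-turn about the bond `pos (0, 0, 1)`: swaps families `1` and `3` up to sign. -/
theorem halfTurn_step_13 :
    ∃ R : EuclideanSpace ℝ (Fin 3) ≃ₗᵢ[ℝ] EuclideanSpace ℝ (Fin 3),
      (∀ p ∈ fccStacking 1 (Real.sqrt (2 / 3)), R p ∈ fccStacking 1 (Real.sqrt (2 / 3))) ∧
      (∀ p ∈ fccStacking 1 (Real.sqrt (2 / 3)), R.symm p ∈ fccStacking 1 (Real.sqrt (2 / 3))) ∧
      R ((1 / 3 : ℝ) • barlowPos 1 (Real.sqrt (2 / 3)) constHagg 3 (-1) (-1)) = -((1 / 3 : ℝ) • barlowPos 1 (Real.sqrt (2 / 3)) constHagg 3 (-1) (-1)) ∧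
      R ((1 / 3 : ℝ) • barlowPos 1 (Real.sqrt (2 / 3)) constHagg (-1) (-1) 3) = -((1 / 3 : ℝ) • barlowPos 1 (Real.sqrt (2 / 3)) constHagg (-1) (-1) (-1)) ∧
      R ((1 / 3 : ℝ) • barlowPos 1 (Real.sqrt (2 / 3)) constHagg (-1) 3 (-1)) = -((1 / 3 : ℝ) • barlowPos 1 (Real.sqrt (2 / 3)) constHagg (-1) 3 (-1)) ∧
      R ((1 / 3 : ℝ) • barlowPos 1 (Real.sqrt (2 / 3)) constHagg (-1) (-1) (-1)) = -((1 / 3 : ℝ) • barlowPos 1 (Real.sqrt (2 / 3)) constHagg (-1) (-1) 3) := by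
  have hd : ‖barlowPos 1 (Real.sqrt (2 / 3)) constHagg 0 0 1‖ ^ 2 = 1 := by rw [barlowPos_normSq]; push_cast; norm_num
  obtain ⟨R, hR⟩ := exists_halfTurn_pos 0 0 1 hd
  have hl := halfTurn_pos_lattice R 0 0 1 hd hR
  refine ⟨R, hl.1, hl.2, ?_, ?_, ?_, ?_⟩
  · rw [hR, real_inner_smul_left, barlowPos_inner]
    exact third_lincomb 0 0 0 1 3 (-1) (-1) 3 (-1) (-1) _
      (by push_cast; norm_num) (by norm_num) (by norm_num) (by norm_num)
  · rw [hR, real_inner_smul_left, barlowPos_inner]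
    exact third_lincomb 4 0 0 1 (-1) (-1) 3 (-1) (-1) (-1) _
      (by push_cast; norm_num) (by norm_num) (by norm_num) (by norm_num)
  · rw [hR, real_inner_smul_left, barlowPos_inner]
    exact third_lincomb 0 0 0 1 (-1) 3 (-1) (-1) 3 (-1) _
      (by push_cast; norm_num) (by norm_num) (by norm_num) (by norm_num)
  · rw [hR, real_inner_smul_left, barlowPos_inner]
    exact third_lincomb (-4) 0 0 1 (-1) (-1) (-1) (-1) (-1) 3 _
      (by push_cast; norm_num) (by norm_num) (by norm_num) (by norm_num)

/-- Half-turn about the bond `pos (0, 1, 0)`: swaps families `2` and `3` up to sign. -/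
theorem halfTurn_step_23 :
    ∃ R : EuclideanSpace ℝ (Fin 3) ≃ₗᵢ[ℝ] EuclideanSpace ℝ (Fin 3),
      (∀ p ∈ fccStacking 1 (Real.sqrt (2 / 3)), R p ∈ fccStacking 1 (Real.sqrt (2 / 3))) ∧
      (∀ p ∈ fccStacking 1 (Real.sqrt (2 / 3)), R.symm p ∈ fccStacking 1 (Real.sqrt (2 / 3))) ∧
      R ((1 / 3 : ℝ) • barlowPos 1 (Real.sqrt (2 / 3)) constHagg 3 (-1) (-1)) = -((1 / 3 : ℝ) • barlowPos 1 (Real.sqrt (2 / 3)) constHagg 3 (-1) (-1)) ∧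
      R ((1 / 3 : ℝ) • barlowPos 1 (Real.sqrt (2 / 3)) constHagg (-1) (-1) 3) = -((1 / 3 : ℝ) • barlowPos 1 (Real.sqrt (2 / 3)) constHagg (-1) (-1) 3) ∧
      R ((1 / 3 : ℝ) • barlowPos 1 (Real.sqrt (2 / 3)) constHagg (-1) 3 (-1)) = -((1 / 3 : ℝ) • barlowPos 1 (Real.sqrt (2 / 3)) constHagg (-1) (-1) (-1)) ∧
      R ((1 / 3 : ℝ) • barlowPos 1 (Real.sqrt (2 / 3)) constHagg (-1) (-1) (-1)) = -((1 / 3 : ℝ) • barlowPos 1 (Real.sqrt (2 / 3)) constHagg (-1) 3 (-1)) := by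
  have hd : ‖barlowPos 1 (Real.sqrt (2 / 3)) constHagg 0 1 0‖ ^ 2 = 1 := by rw [barlowPos_normSq]; push_cast; norm_num
  obtain ⟨R, hR⟩ := exists_halfTurn_pos 0 1 0 hd
  have hl := halfTurn_pos_lattice R 0 1 0 hd hR
  refine ⟨R, hl.1, hl.2, ?_, ?_, ?_, ?_⟩
  · rw [hR, real_inner_smul_left, barlowPos_inner]
    exact third_lincomb 0 0 1 0 3 (-1) (-1) 3 (-1) (-1) _
      (by push_cast; norm_num) (by norm_num) (by norm_num) (by norm_num)
  · rw [hR, real_inner_smul_left, barlowPos_inner]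
    exact third_lincomb 0 0 1 0 (-1) (-1) 3 (-1) (-1) 3 _
      (by push_cast; norm_num) (by norm_num) (by norm_num) (by norm_num)
  · rw [hR, real_inner_smul_left, barlowPos_inner]
    exact third_lincomb 4 0 1 0 (-1) 3 (-1) (-1) (-1) (-1) _
      (by push_cast; norm_num) (by norm_num) (by norm_num) (by norm_num)
  · rw [hR, real_inner_smul_left, barlowPos_inner]
    exact third_lincomb (-4) 0 1 0 (-1) (-1) (-1) (-1) 3 (-1) _
      (by push_cast; norm_num) (by norm_num) (by norm_num) (by norm_num)

end Summit.Ventures.Crystal3D.Theorems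

end
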